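import Mathlib.MeasureTheory.Integral.DominatedConvergence
import Mathlib.Order.Filter.AtTopBot.Archimedean
import Literature.Probability.RandomPlanarGeometry.RestrictionHulls
import Literature.Probability.RandomPlanarGeometry.SLEBoundaryHitting
import Literature.Probability.RandomPlanarGeometry.LocalMartingale
import Literature.Probability.RandomPlanarGeometry.LoewnerFlow
import HarnessLib

/-!
# The restriction martingale `h_t'(W_t)^{5/8}` of SLE_{8/3} ([LSW] §5–§6): the probabilistic skeleton of Thm. 6.1

Level 2 of the decomposition of the named fact `Literature.Probability.RandomPlanarGeometry.sle_restriction_eightThirds` (file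
`RestrictionHulls`: [LSW] Thm. 6.1 verbatim, the half-plane form of
`Literature.Probability.RandomPlanarGeometry.IsSLELaw.hullRestriction_eightThirds` of `ConformalRestrictionProofs`), after

* G. F. Lawler, O. Schramm, W. Werner, *Conformal restriction: the chordal case*, J. Amer. Math.
  Soc. **16** (2003) 917–955, arXiv:math/0209343 (**[LSW]**), §5 "Conformal image of chordal
  SLE" and §6 "Restriction property for SLE_{8/3}";
* the same argument in book form: G. F. Lawler, *Conformally Invariant Processes in the Plane*,
  AMS (2005), §6.4, Thm. 6.17 with (6.4)–(6.5), Lemma 6.15 and Prop. 6.19 (**[Law]**).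

The printed proof of Thm. 6.1 (§6, first paragraph after Lemma 6.3): "By Proposition 3.3, it
suffices to consider the case where `A` is a smooth hull in `𝒬₊ ∪ 𝒬₋`. By symmetry, we may take
`A ∈ 𝒬₊`. Proposition 5.2 shows that `Y_t = h_t'(W_t)^{5/8}` is a bounded continuous local
martingale. By the martingale convergence theorem, the a.s. limit `Y_T := lim_{t ↗ T} Y_t`
exists and `Y_0 = E[Y_T]`, where `T = sup{t : γ[0,t] ∩ A = ∅}`. Lemmas 6.2 and 6.3 show that
`Y_T = 1_{T = ∞}` a.s. This proves the theorem." Here ([LSW] §5) `g_t` is the Loewner flow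
driven by `W_t = √κ B_t`, `A_t = g_t(A)`, `h_t = g_{A_t}` is the hydrodynamically normalized
map of `ℍ ∖ A_t`, so that `h_t'(W_t) = Φ'_{A_t − W_t}(0)` is the number `Φ'_B(0)` of
`RestrictionHulls` (`HasRestrictionDeriv`) for the `*`-hull `B = A_t − W_t`, the hull `A` seen
from the tip of the curve at time `t` (`Φ_{B}(z) = g_{A_t}(z + W_t) − g_{A_t}(W_t)`), and
`Y_0 = Φ'_A(0)^{5/8}`.

This file separates the inputs of that paragraph and PROVES its deductions:

* `Literature.Loewner.slidHull W A t = (g_t(·) − W_t) '' A` — the hull `A_t − W_t` seen from the tip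
  (deterministic, for any driving function `W`, through the tree's Loewner map `Loewner.map`);
* `Literature.IsRestrictionMartingale A Y` — the specification of the process `Y` of the proof: a
  `[0, 1]`-valued martingale for the Brownian filtration `brownianFiltration` under the
  pre-Wiener measure which, almost surely, equals `Φ'_{A_t − W_t}(0)^{5/8}` at every time `t`
  before the hitting time `T = inf{t : γ(t) ∈ A}` of `A` by the SLE_{8/3} trace
  (`firstHit (sleTrace (8/3) ω) A`, file `SLEBoundaryHitting`), is frozen at its left limit
  `Y_T` from time `T` on, and has a limit at `∞` when `T = ∞`;
* `Literature.Probability.RandomPlanarGeometry.sle_exists_isRestrictionMartingale` — NAMED FACT, [LSW] Prop. 5.2 with Prop. 5.3 at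
  `κ = 8/3` (`α = 5/8`, `λ = 0`: "`Y_t`, `t < T`, is a bounded martingale, `0 ≤ Y_t ≤ 1`") and
  the first paragraph of the proof of Thm. 6.1 ("the a.s. limit `Y_T` exists"): for every
  `A ∈ 𝒬*` such a process exists (the deep input: Itô's formula for `h_t(W_t)`, (5.1)–(5.3));
* `Literature.Probability.RandomPlanarGeometry.sle_restrictionDeriv_frequently_gt A`,
  `Literature.Probability.RandomPlanarGeometry.sle_restrictionDeriv_frequently_lt A` — the
  conclusions of [LSW] Lemma 6.2 (on `{T = ∞}`: `g_{A_t}'(W_t)` comes close to `1` at large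
  times) and Lemma 6.3 (on `{T < ∞}`: `Φ_{A_t}'(W_t)` comes close to `0` as `t ↗ T`) for the
  SLE_{8/3} flow,
  as PROPERTIES of the hull `A` (parametric `Prop`s, not asserted): [LSW] proves the first for
  `A ∈ 𝒬₊` (extremal length) and the second for SMOOTH hulls (harmonic measure), which is why
  they are hypotheses here — discharged downstream from the printed Lemmas 6.2 and 6.3 for
  `A ∈ 𝒬₊ ∪ 𝒬₋`, resp. for smooth hulls (files `SLERestrictionLemmas`, `LoewnerReflection`,
  `SLERestrictionSmooth`);
* `Literature.Probability.RandomPlanarGeometry.IsRestrictionMartingale.ae_tendsto_indicator` — PROVED: a restriction martingale of a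
  `*`-hull with these two properties converges a.s. to `1_{T = ∞}` ("Lemmas 6.2 and 6.3 show that
  `Y_T = 1_{T=∞}` a.s.");
* `Literature.Probability.RandomPlanarGeometry.IsRestrictionMartingale.measure_disjoint_eq` — PROVED: for `A ∈ 𝒬*` with restriction
  map `Φ_A` and `Φ'_A(0) = d`, a restriction martingale `Y` with `Y_t → 1_{T=∞}` a.s. gives
  `P[γ[0,∞) ∩ A = ∅] = d^{5/8}` — the deduction of the quoted paragraph, with Mathlib's
  martingales: `E[Y_n] = E[Y_0] = d^{5/8}` (`Martingale.setIntegral_eq`; `Y_0 = Φ'_A(0)^{5/8}`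
  by uniqueness of `Φ_A`, hypothesis `huniq` = `IsStarHull.existsUnique_isRestrictionMap`),
  dominated convergence along `t = n → ∞`, and `{T = ∞} = {γ[0,∞) ∩ A = ∅}`;
* `Literature.Probability.RandomPlanarGeometry.sle_restriction_eightThirds_of_limits` (and `_of_martingale`) — PROVED: hence [LSW]
  Thm. 6.1 (`sle_restriction_eightThirds`) follows from the named fact together with the two
  limit properties for all `*`-hulls (in print: for smooth `±`-hulls, then all of `𝒬*` by
  Prop. 3.3 (4) ⇒ (3), i.e. Lemma 2.1's smooth approximation — the step to be threaded with the
  smooth hulls).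

Non-vacuity: for the empty hull, `T = ∞`, `A_t − W_t = ∅`, `Φ_∅ = id`, and the constant process
`1` is a restriction martingale (`isRestrictionMartingale_empty`).

Mathlib: `MeasureTheory.Martingale` (with `Martingale.setIntegral_eq`, `martingale_const`),
`MeasureTheory.tendsto_integral_of_dominated_convergence`, `aestronglyMeasurable_of_tendsto_ae`,
`NullMeasurableSet.exists_measurable_subset_ae_eq`; no stochastic integral, local martingales on
stochastic intervals or continuous-time martingale convergence are needed for the deduction.
Tree: `Loewner.map` / `map_zero_apply` (`LoewnerChain`, `LoewnerFlow`), `sleTrace`, `sleDriving`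
(`SLE`), `firstHit` (`SLEBoundaryHitting`), `brownianFiltration` (`LocalMartingale`),
`IsStarHull`, `IsRestrictionMap`, `HasRestrictionDeriv`, `sle_restriction_eightThirds`
(`RestrictionHulls`).
-/

noncomputable section

open Set Filter Topology MeasureTheory
open UpperHalfPlane (upperHalfPlaneSet)
open scoped NNReal ENNReal

namespace Literature.Probability.RandomPlanarGeometry

/-! ### Two complements on the Loewner trace and first hitting times -/

/-- The Loewner trace is continuous (it is the generating curve when the chain is generated by a
curve, a constant curve otherwise). [folklore] -/
theorem Loewner.continuous_trace (W : ℝ≥0 → ℝ) : Continuous (Loewner.trace W) := by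
  classical
  by_cases h : ∃ γ, Loewner.IsGeneratedByCurve W γ
  · exact (Loewner.isGeneratedByCurve_trace h).continuous
  · rw [Loewner.trace, dif_neg h]
    exact continuous_const

/-- The SLE trace is continuous, for every sample point. [folklore] -/
theorem continuous_sleTrace (κ : ℝ≥0) (ω : ℝ≥0 → ℝ) : Continuous (sleTrace κ ω) :=
  Loewner.continuous_trace _

/-- The first hitting time of `S` is `⊤` iff `S` is never hit. [folklore] -/
theorem firstHit_eq_top_iff {γ : ℝ≥0 → ℂ} {S : Set ℂ} : firstHit γ S = ⊤ ↔ ∀ t, γ t ∉ S := by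
  refine ⟨fun h t ht ↦ ?_, firstHit_eq_top⟩
  have := firstHit_le ht
  rw [h, top_le_iff] at this
  exact WithTop.coe_ne_top this

/-- The first hitting time of `S` is `⊤` iff the trace of the path is disjoint from `S`.
[folklore] -/
theorem firstHit_eq_top_iff_disjoint {γ : ℝ≥0 → ℂ} {S : Set ℂ} :
    firstHit γ S = ⊤ ↔ Disjoint (range γ) S := by
  rw [firstHit_eq_top_iff, Set.disjoint_left]
  simp only [mem_range, forall_exists_index, forall_apply_eq_imp_iff]

/-- A continuous path starting off the closed set `S` hits it at a positive time (if ever).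
[folklore] -/
theorem firstHit_pos {γ : ℝ≥0 → ℂ} {S : Set ℂ} (hγ : Continuous γ) (hS : IsClosed S)
    (h0 : γ 0 ∉ S) : (0 : WithTop ℝ≥0) < firstHit γ S := by
  rcases eq_or_ne (firstHit γ S) ⊤ with h | h
  · rw [h]
    exact WithTop.coe_lt_top 0
  · obtain ⟨t₀, ht₀, hmem⟩ := exists_firstHit_eq_coe hγ hS h
    rw [ht₀, ← WithTop.coe_zero, WithTop.coe_lt_coe, pos_iff_ne_zero]
    rintro rfl
    exact h0 hmem

/-- The SLE trace starts off every closed set not containing the origin, so it hits such a set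
at a positive time (if ever): `T_A > 0` for `A ∈ 𝒬*`. [folklore] -/
theorem firstHit_sleTrace_pos (κ : ℝ≥0) {A : Set ℂ} (hA : IsClosed A) (h0 : (0 : ℂ) ∉ A)
    (ω : ℝ≥0 → ℝ) : (0 : WithTop ℝ≥0) < firstHit (sleTrace κ ω) A := by
  refine firstHit_pos (continuous_sleTrace κ ω) hA ?_
  change Loewner.trace (sleDriving κ ω) 0 ∉ A
  rwa [Loewner.trace_zero, sleDriving_zero, Complex.ofReal_zero]

/-! ### The hull seen from the tip: `A_t − W_t` ([LSW] §5) -/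

namespace Loewner

variable {W : ℝ≥0 → ℝ} {A : Set ℂ}

/-- **The hull `A` seen from the tip at time `t`**: `A_t − W_t = {g_t(z) − W_t : z ∈ A}`, where
`g_t = Loewner.map W t` is the Loewner map and `A_t = g_t(A)` ([LSW] §5: "Suppose that
`A ∈ 𝒬*` is fixed … For `t < T`, let `A_t = g_t(A)`", with `h_t = g_{A_t}` and
`W̃_t = h_t(W_t)`). Translating by `−W_t` puts the tip `W_t` of the mapped curve at the origin,
so that `h_t'(W_t) = Φ'_{A_t − W_t}(0)` in the vocabulary of `RestrictionHulls`
(`Φ_{A_t − W_t}(z) = g_{A_t}(z + W_t) − g_{A_t}(W_t)`). Meaningful for `t` before the hitting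
time of `A` (afterwards `Loewner.map` carries junk values on swallowed points).
[cite: LawlerSchrammWerner2003Restriction, §5 (A_t = g_t(A), h_t = g_{A_t})] -/
def slidHull (W : ℝ≥0 → ℝ) (A : Set ℂ) (t : ℝ≥0) : Set ℂ :=
  (fun z ↦ map W t z - W t) '' A

/-- Membership in the slid hull. [folklore] -/
theorem mem_slidHull_iff {t : ℝ≥0} {w : ℂ} :
    w ∈ slidHull W A t ↔ ∃ z ∈ A, map W t z - W t = w := Iff.rfl

/-- The slid hull of the empty set is empty. [folklore] -/
@[simp] theorem slidHull_empty (W : ℝ≥0 → ℝ) (t : ℝ≥0) : slidHull W ∅ t = ∅ :=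
  image_empty _

/-- At time `0` the slid hull is the translate `A − W_0` (`g_0 = id` off the driving point,
`map_zero_apply`). [folklore] -/
theorem slidHull_zero (hW : Continuous W) (hA : (W 0 : ℂ) ∉ A) :
    slidHull W A 0 = (fun z : ℂ ↦ z - (W 0 : ℂ)) '' A := by
  refine image_congr fun z hz ↦ ?_
  rw [map_zero_apply hW (fun h ↦ hA (h ▸ hz))]

end Loewner

/-- For the SLE driving function (`W_0 = 0`) the slid hull at time `0` is `A` itself, for `A`
off the origin. [folklore] -/
theorem slidHull_sleDriving_zero (κ : ℝ≥0) {A : Set ℂ} (hA : (0 : ℂ) ∉ A) (ω : ℝ≥0 → ℝ) :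
    Loewner.slidHull (sleDriving κ ω) A 0 = A := by
  rw [Loewner.slidHull_zero (continuous_sleDriving κ ω) (by simpa using hA)]
  simp

/-! ### The restriction martingale of [LSW] Prop. 5.2 / proof of Thm. 6.1 -/

/-- **Specification of the restriction martingale `Y` of SLE_{8/3} for the hull `A`** ([LSW]
Prop. 5.2–5.3 and proof of Thm. 6.1): a real process `Y` on the canonical space
`(ℝ≥0 → ℝ, preWienerMeasure)` such that

* `0 ≤ Y_t ≤ 1` (Prop. 5.3: "`0 ≤ Y_t ≤ 1`", from (2.4));
* `Y` is a martingale for the Brownian filtration `𝓕ᵂ` (Prop. 5.3 at `κ = 8/3`, `λ = 0`: "`Y_t`,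
  `t < T`, is a bounded martingale"; extended past `T` by its left limit `Y_T` it stays a bounded
  martingale on `[0, ∞)` — conditional bounded convergence along a localizing sequence
  `τₙ ↗ T`, `Y_t = limₙ Y_{t ∧ τₙ}`; Revuz–Yor (1999), Ch. IV §1);
* almost surely, for every `t` before the hitting time `T = inf{t : γ(t) ∈ A}` of `A` by the
  SLE_{8/3} trace `γ`, `Y_t = Φ'_{A_t − W_t}(0)^{5/8} = h_t'(W_t)^{5/8}` for a (the) restriction
  map of the slid hull `A_t − W_t` and its derivative at `0` (`IsRestrictionMap`,
  `HasRestrictionDeriv` of `RestrictionHulls`; Prop. 5.2: `Y⁰_t = h_t'(W_t)^{5/8}`, `t < T`),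
  a number in `(0, 1]` ([LSW] (2.4): "`0 < g_A'(x) ≤ 1`, `x ∈ ℝ ∖ A`", here
  `h_t'(W_t) = g_{A_t}'(W_t)`, `W_t ∈ ℝ ∖ A_t`);
* almost surely, from time `T` on, `Y` is frozen at the left limit `Y_T = lim_{s ↗ T} Y_s`,
  and on `{T = ∞}` the limit `lim_{t → ∞} Y_t` exists (proof of Thm. 6.1: "By the martingale
  convergence theorem, the a.s. limit `Y_T := lim_{t ↗ T} Y_t` exists").

In [LSW] `T = inf{t : K_t ∩ A ≠ ∅}` (§5) `= sup{t : γ[0,t] ∩ A = ∅}` (proof of Thm. 6.1); for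
SLE_{8/3}, whose trace is a simple curve generating the hulls, these agree a.s. with the first
hitting time `firstHit (sleTrace (8/3) ω) A` used here.
[cite: LawlerSchrammWerner2003Restriction, Prop. 5.2, Prop. 5.3 and proof of Thm. 6.1 (§§5–6)] -/
structure IsRestrictionMartingale (A : Set ℂ) (Y : ℝ≥0 → (ℝ≥0 → ℝ) → ℝ) : Prop where
  /-- `0 ≤ Y_t ≤ 1`. -/
  mem_Icc : ∀ t ω, Y t ω ∈ Icc (0 : ℝ) 1
  /-- `Y` is an `𝓕ᵂ`-martingale under the pre-Wiener measure. -/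
  martingale : Martingale Y brownianFiltration Process.preWienerMeasure
  /-- A.s., before the hitting time of `A`, `Y_t = Φ'_{A_t − W_t}(0)^{5/8}` with
  `0 < Φ'_{A_t − W_t}(0) ≤ 1`. -/
  ae_exists_eq_rpow : ∀ᵐ ω ∂Process.preWienerMeasure, ∀ t : ℝ≥0,
    (t : WithTop ℝ≥0) < firstHit (sleTrace ((8 : ℝ≥0) / 3) ω) A →
      ∃ (Ψ : ConformalEquiv
          (upperHalfPlaneSet \ Loewner.slidHull (sleDriving ((8 : ℝ≥0) / 3) ω) A t)
          upperHalfPlaneSet) (e : ℝ),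
        IsRestrictionMap (Loewner.slidHull (sleDriving ((8 : ℝ≥0) / 3) ω) A t) Ψ ∧
          HasRestrictionDeriv (Loewner.slidHull (sleDriving ((8 : ℝ≥0) / 3) ω) A t) Ψ e ∧
          0 < e ∧ e ≤ 1 ∧ Y t ω = e ^ ((5 : ℝ) / 8)
  /-- A.s., from the hitting time `T < ∞` on, `Y` equals its left limit at `T`. -/
  ae_frozen : ∀ᵐ ω ∂Process.preWienerMeasure, ∀ τ : ℝ≥0,
    firstHit (sleTrace ((8 : ℝ≥0) / 3) ω) A = τ →
      ∀ t : ℝ≥0, τ ≤ t → Tendsto (fun s ↦ Y s ω) (𝓝[<] τ) (𝓝 (Y t ω))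
  /-- A.s., if `A` is never hit (`T = ∞`), the limit `lim_{t → ∞} Y_t` exists. -/
  ae_exists_tendsto : ∀ᵐ ω ∂Process.preWienerMeasure, firstHit (sleTrace ((8 : ℝ≥0) / 3) ω) A = ⊤ →
    ∃ c : ℝ, Tendsto (fun t ↦ Y t ω) atTop (𝓝 c)

/-- NAMED FACT — **[LSW] Prop. 5.2 with Prop. 5.3 (`κ = 8/3`): the restriction martingale
exists.** Prop. 5.2: "Suppose `b_t = 0` (i.e., `W_t = √κ B_t`), `a > 0`, `κ > 0`. The process
`Y⁰_t = h_t'(W_t)^a`, `t < T`, is a local martingale for all `A ∈ 𝒬*` if and only if `κ = 8/3`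
and `a = 5/8`." Prop. 5.3 (with `α = (6−κ)/(2κ) = 5/8`, `λ = (8−3κ)(6−κ)/(2κ) = 0` at
`κ = 8/3`): "If `κ ≤ 8/3`, then `Y_t` [`t < T`] is a bounded martingale (in fact,
`0 ≤ Y_t ≤ 1`)." Proof of Thm. 6.1: "By the martingale convergence theorem, the a.s. limit
`Y_T := lim_{t ↗ T} Y_t` exists" (`T ≤ ∞`). Packaged as: for every `A ∈ 𝒬*` there is a process
satisfying `IsRestrictionMartingale A` (the process `h_t'(W_t)^{5/8}` before `T`, frozen at its
left limit afterwards, convergent at `∞` on `{T = ∞}`). The printed proof is Itô's formula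
for the random conformal maps `h_t = g̃_t ∘ g_A ∘ g_t⁻¹` ((5.1)–(5.3)), not available in
Mathlib. Book form: Lawler (2005), §6.4, (6.5) and Prop. 6.19 ("If `κ ≤ 8/3`, then `Y_t` is a
bounded martingale"), proof of Thm. 6.17 ("`M_{t ∧ t_A} → M_∞` with probability one").
[cite: LawlerSchrammWerner2003Restriction, Prop. 5.2 and Prop. 5.3 (§5), proof of Thm. 6.1 (§6)] -/
def sle_exists_isRestrictionMartingale : Prop :=
  ∀ {A : Set ℂ}, IsStarHull A → ∃ Y, IsRestrictionMartingale A Y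

/-! ### Non-vacuity: the empty hull -/

/-- Restriction data for a set equal to `∅`: the identity with `Φ'_∅(0) = 1` (transported
along the equality). [folklore] -/
theorem exists_isRestrictionMap_of_eq_empty {B : Set ℂ} (hB : B = ∅) :
    ∃ (Ψ : ConformalEquiv (upperHalfPlaneSet \ B) upperHalfPlaneSet) (e : ℝ),
      IsRestrictionMap B Ψ ∧ HasRestrictionDeriv B Ψ e ∧ 0 < e ∧ e ≤ 1 ∧
        (1 : ℝ) = e ^ ((5 : ℝ) / 8) := by
  subst hB
  exact ⟨restrictionMapEmpty, 1, isRestrictionMap_empty, hasRestrictionDeriv_empty, one_pos, le_rfl,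
    (Real.one_rpow _).symm⟩

/-- **The constant process `1` is a restriction martingale for the empty hull** (`T = ∞`,
`A_t − W_t = ∅`, `Φ_∅ = id`, `Φ'_∅(0) = 1`): the specification is satisfiable. [folklore] -/
theorem isRestrictionMartingale_empty [Fact Process.isProjectiveLimit_preWienerMeasure] :
    IsRestrictionMartingale ∅ fun _ _ ↦ 1 where
  mem_Icc _ _ := ⟨zero_le_one, le_rfl⟩
  martingale := martingale_const _ _ _
  ae_exists_eq_rpow := Eventually.of_forall fun ω t _ ↦
    exists_isRestrictionMap_of_eq_empty (Loewner.slidHull_empty _ _)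
  ae_frozen := Eventually.of_forall fun ω τ hτ ↦ by
    rw [firstHit_eq_top fun t ↦ notMem_empty _] at hτ
    exact absurd hτ WithTop.top_ne_coe
  ae_exists_tendsto := Eventually.of_forall fun _ _ ↦ ⟨1, tendsto_const_nhds⟩

/-! ### The deduction of Thm. 6.1 from the martingale -/

section Deduction

variable {A : Set ℂ} {Φ Ψ : ConformalEquiv (upperHalfPlaneSet \ A) upperHalfPlaneSet} {d e : ℝ}

/-- `Φ'_A(0)` only depends on the values of the map on `ℍ ∖ A`. [folklore] -/
theorem HasRestrictionDeriv.of_eqOn (h : HasRestrictionDeriv A Ψ e)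
    (hΨΦ : EqOn Ψ Φ (upperHalfPlaneSet \ A)) : HasRestrictionDeriv A Φ e :=
  h.congr' (eventually_nhdsWithin_of_forall fun z hz ↦ by rw [hΨΦ hz])

/-- With uniqueness of the restriction map (`IsStarHull.existsUnique_isRestrictionMap`,
hypothesis `huniq`), the number `Φ'_A(0)` does not depend on the restriction map used to
compute it. [folklore] -/
theorem HasRestrictionDeriv.eq_of_isRestrictionMap
    (huniq : IsStarHull.existsUnique_isRestrictionMap) (hA : IsStarHull A)
    (hΦ : IsRestrictionMap A Φ) (hΨ : IsRestrictionMap A Ψ) (hd : HasRestrictionDeriv A Φ d)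
    (he : HasRestrictionDeriv A Ψ e) : e = d := by
  obtain ⟨Φ₀, -, hU⟩ := huniq hA
  exact (he.of_eqOn (hU Ψ hΨ)).unique hA (hd.of_eqOn (hU Φ hΦ))

variable {Y : ℝ≥0 → (ℝ≥0 → ℝ) → ℝ}

/-- **`Y_0 = Φ'_A(0)^{5/8}` a.s.**: at time `0` the slid hull is `A` (`W_0 = 0`, `g_0 = id`) and
`T > 0`. [cite: LawlerSchrammWerner2003Restriction, proof of Thm. 6.1 (Y_0 = Φ'_A(0)^{5/8})] -/
theorem IsRestrictionMartingale.ae_apply_zero (huniq : IsStarHull.existsUnique_isRestrictionMap)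
    (hA : IsStarHull A) (hΦ : IsRestrictionMap A Φ) (hd : HasRestrictionDeriv A Φ d)
    (hY : IsRestrictionMartingale A Y) :
    ∀ᵐ ω ∂Process.preWienerMeasure, Y 0 ω = d ^ ((5 : ℝ) / 8) := by
  have key : ∀ B : Set ℂ, B = A →
      ∀ (Ψ : ConformalEquiv (upperHalfPlaneSet \ B) upperHalfPlaneSet) (e : ℝ),
        IsRestrictionMap B Ψ → HasRestrictionDeriv B Ψ e → e = d := by
    rintro B rfl Ψ e hΨ he
    exact HasRestrictionDeriv.eq_of_isRestrictionMap huniq hA hΦ hΨ hd he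
  filter_upwards [hY.ae_exists_eq_rpow] with ω hω
  obtain ⟨Ψ, e, hΨ, he, -, -, h0⟩ :=
    hω 0 (firstHit_sleTrace_pos _ hA.isBoundedHull.isClosed hA.zero_notMem ω)
  rw [h0, key _ (slidHull_sleDriving_zero _ hA.zero_notMem ω) Ψ e hΨ he]

/-- **The expectation of the restriction martingale is constant, `E[Y_t] = Φ'_A(0)^{5/8}`**
(martingale property, `Martingale.setIntegral_eq` on the whole space). [folklore] -/
theorem IsRestrictionMartingale.integral_eq [Fact Process.isProjectiveLimit_preWienerMeasure]
    (huniq : IsStarHull.existsUnique_isRestrictionMap) (hA : IsStarHull A)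
    (hΦ : IsRestrictionMap A Φ) (hd : HasRestrictionDeriv A Φ d) (hY : IsRestrictionMartingale A Y)
    (t : ℝ≥0) : ∫ ω, Y t ω ∂Process.preWienerMeasure = d ^ ((5 : ℝ) / 8) := by
  have h := hY.martingale.setIntegral_eq (show (0 : ℝ≥0) ≤ t from bot_le)
    (MeasurableSet.univ (α := ℝ≥0 → ℝ))
  simp only [Measure.restrict_univ] at h
  rw [← h, integral_congr_ae (hY.ae_apply_zero huniq hA hΦ hd), integral_const, smul_eq_mul,
    probReal_univ, one_mul]

/-- **Thm. 6.1 for the hull `A` from its restriction martingale** — the deduction printed in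
the proof of [LSW] Thm. 6.1: if `Y` is a restriction martingale for `A ∈ 𝒬*` and
`Y_t → 1_{T = ∞}` almost surely (in print: "Lemmas 6.2 and 6.3 show that `Y_T = 1_{T=∞}`
a.s.", for smooth hulls), then `P[γ[0, ∞) ∩ A = ∅] = Φ'_A(0)^{5/8}`. Proof:
`E[Y_n] = E[Y_0] = Φ'_A(0)^{5/8}` for all `n` (martingale; `Y_0` by uniqueness of `Φ_A`,
hypothesis `huniq`), `E[Y_n] → P[T = ∞]` by dominated convergence (`0 ≤ Y ≤ 1`), and
`{T = ∞} = {γ[0, ∞) ∩ A = ∅}`. [cite: LawlerSchrammWerner2003Restriction, proof of Thm. 6.1 (§6)] -/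
theorem IsRestrictionMartingale.measure_disjoint_eq [Fact Process.isProjectiveLimit_preWienerMeasure]
    (huniq : IsStarHull.existsUnique_isRestrictionMap) (hA : IsStarHull A)
    (hΦ : IsRestrictionMap A Φ) (hd : HasRestrictionDeriv A Φ d) (hY : IsRestrictionMartingale A Y)
    (hlim : ∀ᵐ ω ∂Process.preWienerMeasure, Tendsto (fun t ↦ Y t ω) atTop
      (𝓝 (if firstHit (sleTrace ((8 : ℝ≥0) / 3) ω) A = ⊤ then 1 else 0))) :
    Process.preWienerMeasure {ω | Disjoint (range (sleTrace ((8 : ℝ≥0) / 3) ω)) A} =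
      ENNReal.ofReal (d ^ ((5 : ℝ) / 8)) := by
  set P : Measure (ℝ≥0 → ℝ) := Process.preWienerMeasure with hP
  set f : (ℝ≥0 → ℝ) → ℝ := fun ω ↦
    if firstHit (sleTrace ((8 : ℝ≥0) / 3) ω) A = ⊤ then 1 else 0 with hf
  -- the integrals `E[Y_n]` are constant
  have hint : ∀ n : ℕ, ∫ ω, Y n ω ∂P = d ^ ((5 : ℝ) / 8) := fun n ↦
    hY.integral_eq huniq hA hΦ hd n
  -- dominated convergence along `t = n`
  have hmeas : ∀ n : ℕ, AEStronglyMeasurable (Y n) P := fun n ↦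
    (hY.martingale.integrable _).aestronglyMeasurable
  have hlim' : ∀ᵐ ω ∂P, Tendsto (fun n : ℕ ↦ Y n ω) atTop (𝓝 (f ω)) := by
    filter_upwards [hlim] with ω hω
    exact hω.comp tendsto_natCast_atTop_atTop
  have hbound : ∀ n : ℕ, ∀ᵐ ω ∂P, ‖Y n ω‖ ≤ (1 : ℝ) := fun n ↦
    Eventually.of_forall fun ω ↦ by
      rw [Real.norm_eq_abs, abs_le]
      have h := hY.mem_Icc n ω
      exact ⟨by linarith [h.1], h.2⟩
  have hDCT := tendsto_integral_of_dominated_convergence (fun _ ↦ (1 : ℝ)) hmeas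
    (integrable_const 1) hbound hlim'
  have hfint : ∫ ω, f ω ∂P = d ^ ((5 : ℝ) / 8) := by
    refine tendsto_nhds_unique hDCT ?_
    simp_rw [hint]
    exact tendsto_const_nhds
  -- the limit is the indicator of `{T = ∞}`, a null-measurable set
  have hfm : AEStronglyMeasurable f P := aestronglyMeasurable_of_tendsto_ae atTop hmeas hlim'
  set E : Set (ℝ≥0 → ℝ) := {ω | firstHit (sleTrace ((8 : ℝ≥0) / 3) ω) A = ⊤} with hE
  have hEf : E = f ⁻¹' {1} := by
    ext ω
    simp only [hE, hf, mem_setOf_eq, mem_preimage, mem_singleton_iff]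
    split_ifs with h <;> simp [h]
  have hEnull : NullMeasurableSet E P := by
    rw [hEf]
    exact hfm.aemeasurable.nullMeasurableSet_preimage (measurableSet_singleton 1)
  obtain ⟨E', -, hE'm, hE'eq⟩ := hEnull.exists_measurable_subset_ae_eq
  have hfind : f = E.indicator 1 := by
    ext ω
    simp only [hf, hE, indicator, mem_setOf_eq, Pi.one_apply]
  have hfE' : ∫ ω, f ω ∂P = P.real E' := by
    rw [hfind, integral_congr_ae (indicator_ae_eq_of_ae_eq_set hE'eq.symm),
      integral_indicator_one hE'm]
  -- conclusion
  have hset : {ω | Disjoint (range (sleTrace ((8 : ℝ≥0) / 3) ω)) A} = E := by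
    ext ω
    simp only [hE, mem_setOf_eq, firstHit_eq_top_iff_disjoint]
  rw [hset, ← measure_congr hE'eq, ← ofReal_measureReal, ← hfE', hfint]

end Deduction

/-! ### The limit step: what Lemmas 6.2 and 6.3 deliver, and `Y_t → 1_{T = ∞}` -/

section Limit

/-- **The conclusion of [LSW] Lemma 6.2 for the SLE_{8/3} flow and the hull `A`** (as used in
the proof of Thm. 6.1 on the event `{T = ∞}`): almost surely, if the trace never hits `A`, then
`Φ'_{A_t − W_t}(0) = g_{A_t}'(W_t)` comes arbitrarily close to `1` at arbitrarily large times.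
Lemma 6.2 (deterministic, `A ∈ 𝒬₊`, any continuous driving function with
`⋃_t K_t ∩ A = ∅`): "`lim_{r → ∞} g'_{A_{T(r)}}(W_{T(r)}) = 1`", `T(r) = sup{t : K_t ⊂ r𝕌}`
(and `T(r) → ∞` since the hulls are bounded). Quantified over all restriction data of the slid
hull (the number `Φ'_B(0)` being unique). A property of `A`; [LSW] proves it for `A ∈ 𝒬₊`
(smoothness is not needed), and uses the reflection `x + iy ↦ −x + iy` for `𝒬₋`; Lawler
(2005), proof of Thm. 6.17: "`lim sup_{t → ∞} M_t^{8/5} = 1` on the event `V_A`" (Beurling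
estimates). A PREDICATE on `A : Set ℂ` (explicit binder), established hull by hull (in the tree for
`A ∈ 𝒬₊ ∪ 𝒬₋` given Lemma 6.2 and the Rohde–Schramm facts, `SLERestrictionLemmas`,
`LoewnerReflection`) — not a closed named fact.
[cite: LawlerSchrammWerner2003Restriction, Lemma 6.2 and proof of Thm. 6.1 (§6)] -/
def sle_restrictionDeriv_frequently_gt (A : Set ℂ) : Prop :=
  ∀ᵐ ω ∂Process.preWienerMeasure, firstHit (sleTrace ((8 : ℝ≥0) / 3) ω) A = ⊤ →
    ∀ ε : ℝ, 0 < ε → ∃ᶠ t : ℝ≥0 in atTop,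
      ∀ (Ψ : ConformalEquiv
          (upperHalfPlaneSet \ Loewner.slidHull (sleDriving ((8 : ℝ≥0) / 3) ω) A t)
          upperHalfPlaneSet) (e : ℝ),
        IsRestrictionMap (Loewner.slidHull (sleDriving ((8 : ℝ≥0) / 3) ω) A t) Ψ →
          HasRestrictionDeriv (Loewner.slidHull (sleDriving ((8 : ℝ≥0) / 3) ω) A t) Ψ e →
            1 - ε < e

/-- **The conclusion of [LSW] Lemma 6.3 for the SLE_{8/3} flow and the hull `A`** (as used in
the proof of Thm. 6.1 on the event `{T < ∞}`), in the weak form that suffices there: almost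
surely, if the trace hits `A` at the finite time `T`, then `Φ'_{A_t − W_t}(0) = Φ_{A_t}'(W_t)`
comes arbitrarily close to `0` as `t ↗ T` (`lim inf = 0`; Lemma 6.3 gives `lim = 0`). Lemma 6.3
(deterministic, `A ∈ 𝒬*` a SMOOTH hull, any continuous driving function with `T < ∞` and
`K_T ∩ A ∩ ℝ = ∅` — for SLE_{8/3} the trace a.s. never returns to `ℝ`):
"`lim_{t ↗ T} Φ'_{A_t}(W_t) = 0`". Quantified over all restriction data of the slid hull. A
property of `A`; [LSW] proves it for smooth hulls (the smoothness of `∂A ∩ ℍ` enters through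
the two arcs of `∂A` at the hitting point); Lawler (2005), proof of Thm. 6.17:
"`lim inf_{t → t_A−} M_t^{8/5} = 0` on `(V_A)^c`" for smooth Jordan hulls. A PREDICATE on
`A : Set ℂ` (explicit binder), established hull by hull — not a closed named fact: it fails for
`A = {0}` (`not_sle_restrictionDeriv_frequently_lt_singleton_zero`) and holds for every smooth
`*`-hull (`sle_restrictionDeriv_frequently_lt_of_isSmoothHull`, both in the proof sibling
`SLERestrictionMartingaleProofs`).
[cite: LawlerSchrammWerner2003Restriction, Lemma 6.3 and proof of Thm. 6.1 (§6)] -/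
def sle_restrictionDeriv_frequently_lt (A : Set ℂ) : Prop :=
  ∀ᵐ ω ∂Process.preWienerMeasure, ∀ τ : ℝ≥0, firstHit (sleTrace ((8 : ℝ≥0) / 3) ω) A = τ →
    ∀ ε : ℝ, 0 < ε → ∃ᶠ s : ℝ≥0 in 𝓝[<] τ,
      ∀ (Ψ : ConformalEquiv
          (upperHalfPlaneSet \ Loewner.slidHull (sleDriving ((8 : ℝ≥0) / 3) ω) A s)
          upperHalfPlaneSet) (e : ℝ),
        IsRestrictionMap (Loewner.slidHull (sleDriving ((8 : ℝ≥0) / 3) ω) A s) Ψ →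
          HasRestrictionDeriv (Loewner.slidHull (sleDriving ((8 : ℝ≥0) / 3) ω) A s) Ψ e →
            e < ε

variable {A : Set ℂ} {Y : ℝ≥0 → (ℝ≥0 → ℝ) → ℝ}

/-- On `{T = ∞}`: a restriction martingale converges to `1` ("Lemma 6.2 shows `Y_T = 1` on
`{T = ∞}`"): its limit at `∞` exists, it is at most `1`, and by Lemma 6.2 it exceeds
`(1 − ε)^{5/8} ≥ 1 − ε` at arbitrarily large times.
[cite: LawlerSchrammWerner2003Restriction, proof of Thm. 6.1 (§6)] -/
theorem IsRestrictionMartingale.ae_tendsto_one (hY : IsRestrictionMartingale A Y)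
    (h62 : sle_restrictionDeriv_frequently_gt A) :
    ∀ᵐ ω ∂Process.preWienerMeasure, firstHit (sleTrace ((8 : ℝ≥0) / 3) ω) A = ⊤ →
      Tendsto (fun t ↦ Y t ω) atTop (𝓝 1) := by
  filter_upwards [hY.ae_exists_eq_rpow, hY.ae_exists_tendsto, h62] with ω hrpow hlim hgt hT
  obtain ⟨c, hc⟩ := hlim hT
  suffices hc1 : c = 1 by rwa [hc1] at hc
  -- `c ≤ 1`
  have hle : c ≤ 1 :=
    le_of_tendsto' hc fun t ↦ (hY.mem_Icc t ω).2
  -- `1 < c + ε` for every `ε > 0`: `Y_t > 1 - ε/2` frequently and `Y_t < c + ε/2` eventually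
  refine le_antisymm hle (le_of_forall_pos_lt_add fun ε hε ↦ ?_)
  have hfreq : ∃ᶠ t : ℝ≥0 in atTop, 1 - ε / 2 < Y t ω := by
    refine (hgt hT (ε / 2) (half_pos hε)).mp (Eventually.of_forall fun t ht ↦ ?_)
    obtain ⟨Ψ, e, hΨ, he, he0, he1, hYt⟩ := hrpow t (by rw [hT]; exact WithTop.coe_lt_top t)
    have h1 : 1 - ε / 2 < e := ht Ψ e hΨ he
    rw [hYt]
    calc 1 - ε / 2 < e := h1
      _ ≤ e ^ ((5 : ℝ) / 8) := Real.self_le_rpow_of_le_one he0.le he1 (by norm_num)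
  -- a limit point bound
  have hev : ∀ᶠ t : ℝ≥0 in atTop, Y t ω < c + ε / 2 :=
    hc (Iio_mem_nhds (by linarith))
  obtain ⟨t, ht1, ht2⟩ := (hfreq.and_eventually hev).exists
  linarith

/-- On `{T < ∞}`: a restriction martingale is `0` from time `T` on ("Lemma 6.3 shows `Y_T = 0`
on `{T < ∞}`"): `Y` is frozen at its left limit `Y_T` at `T`, which is `≥ 0`, and `≤ ε` for
every `ε > 0` because `Y_s = Φ'_{A_s − W_s}(0)^{5/8}` comes below `ε` arbitrarily close to `T`
(Lemma 6.3). [cite: LawlerSchrammWerner2003Restriction, proof of Thm. 6.1 (§6)] -/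
theorem IsRestrictionMartingale.ae_eq_zero_of_le (hA : IsStarHull A)
    (hY : IsRestrictionMartingale A Y) (h63 : sle_restrictionDeriv_frequently_lt A) :
    ∀ᵐ ω ∂Process.preWienerMeasure, ∀ τ : ℝ≥0, firstHit (sleTrace ((8 : ℝ≥0) / 3) ω) A = τ →
      ∀ t : ℝ≥0, τ ≤ t → Y t ω = 0 := by
  filter_upwards [hY.ae_exists_eq_rpow, hY.ae_frozen, h63] with ω hrpow hfrozen hsmall τ hτ t hτt
  -- `τ > 0`, so `𝓝[<] τ` is a proper filter
  have hτ0 : 0 < τ := by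
    have h := firstHit_sleTrace_pos ((8 : ℝ≥0) / 3) hA.isBoundedHull.isClosed hA.zero_notMem ω
    rw [hτ] at h
    exact_mod_cast h
  haveI : (𝓝[<] τ).NeBot := nhdsLT_neBot_of_exists_lt ⟨0, hτ0⟩
  have hlim : Tendsto (fun s ↦ Y s ω) (𝓝[<] τ) (𝓝 (Y t ω)) := hfrozen τ hτ t hτt
  have hlt : ∀ᶠ s : ℝ≥0 in 𝓝[<] τ,
      (s : WithTop ℝ≥0) < firstHit (sleTrace ((8 : ℝ≥0) / 3) ω) A := by
    filter_upwards [self_mem_nhdsWithin] with s hs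
    rw [hτ]
    exact_mod_cast hs
  -- `Y_s < ε'` arbitrarily close to `τ`
  have hfreq : ∀ ε' : ℝ, 0 < ε' → ∃ᶠ s : ℝ≥0 in 𝓝[<] τ, Y s ω < ε' := by
    intro ε' hε'
    have hε : 0 < ε' ^ ((8 : ℝ) / 5) := Real.rpow_pos_of_pos hε' _
    refine ((hsmall τ hτ _ hε).and_eventually hlt).mp (Eventually.of_forall ?_)
    rintro s ⟨hs, hsT⟩
    obtain ⟨Ψ, e, hΨ, he, he0, -, hYs⟩ := hrpow s hsT
    have hes : e < ε' ^ ((8 : ℝ) / 5) := hs Ψ e hΨ he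
    rw [hYs]
    calc e ^ ((5 : ℝ) / 8) < (ε' ^ ((8 : ℝ) / 5)) ^ ((5 : ℝ) / 8) :=
          Real.rpow_lt_rpow he0.le hes (by norm_num)
      _ = ε' := by
          rw [← Real.rpow_mul hε'.le]
          norm_num
  -- hence the left limit is `≤ ε'` for every `ε' > 0`, and it is `≥ 0`
  have hle : ∀ ε' : ℝ, 0 < ε' → Y t ω ≤ ε' := fun ε' hε' ↦ by
    by_contra hgt
    push Not at hgt
    obtain ⟨s, hs1, hs2⟩ := ((hfreq ε' hε').and_eventually (hlim (Ioi_mem_nhds hgt))).exists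
    exact lt_irrefl _ (hs1.trans hs2)
  refine le_antisymm (le_of_forall_pos_lt_add fun ε hε ↦ ?_) (hY.mem_Icc t ω).1
  linarith [hle (ε / 2) (half_pos hε)]

/-- **`Y_t → 1_{T = ∞}` almost surely** ("Lemmas 6.2 and 6.3 show that `Y_T = 1_{T=∞}` a.s."),
for a restriction martingale of a `*`-hull `A` having the two limit properties.
[cite: LawlerSchrammWerner2003Restriction, proof of Thm. 6.1 (§6)] -/
theorem IsRestrictionMartingale.ae_tendsto_indicator (hA : IsStarHull A)
    (hY : IsRestrictionMartingale A Y) (h62 : sle_restrictionDeriv_frequently_gt A)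
    (h63 : sle_restrictionDeriv_frequently_lt A) :
    ∀ᵐ ω ∂Process.preWienerMeasure, Tendsto (fun t ↦ Y t ω) atTop
      (𝓝 (if firstHit (sleTrace ((8 : ℝ≥0) / 3) ω) A = ⊤ then 1 else 0)) := by
  filter_upwards [hY.ae_tendsto_one h62, hY.ae_eq_zero_of_le hA h63] with ω h1 h0
  split_ifs with hT
  · exact h1 hT
  · obtain ⟨τ, hτ⟩ := WithTop.ne_top_iff_exists.1 hT
    refine tendsto_const_nhds.congr' ?_
    filter_upwards [eventually_ge_atTop τ] with t ht
    exact (h0 τ hτ.symm t ht).symm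

/-- **Thm. 6.1 for the hull `A`** from a restriction martingale and the two limit properties
of `A` (Lemmas 6.2, 6.3). [cite: LawlerSchrammWerner2003Restriction, proof of Thm. 6.1 (§6)] -/
theorem IsRestrictionMartingale.measure_disjoint_eq_of_limits
    [Fact Process.isProjectiveLimit_preWienerMeasure] (huniq : IsStarHull.existsUnique_isRestrictionMap)
    (hA : IsStarHull A)
    {Φ : ConformalEquiv (upperHalfPlaneSet \ A) upperHalfPlaneSet} (hΦ : IsRestrictionMap A Φ)
    {d : ℝ} (hd : HasRestrictionDeriv A Φ d) (hY : IsRestrictionMartingale A Y)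
    (h62 : sle_restrictionDeriv_frequently_gt A) (h63 : sle_restrictionDeriv_frequently_lt A) :
    Process.preWienerMeasure {ω | Disjoint (range (sleTrace ((8 : ℝ≥0) / 3) ω)) A} =
      ENNReal.ofReal (d ^ ((5 : ℝ) / 8)) :=
  hY.measure_disjoint_eq huniq hA hΦ hd (hY.ae_tendsto_indicator hA h62 h63)

end Limit

/-- **[LSW] Thm. 6.1 from the restriction martingales**: if for every `A ∈ 𝒬*` a restriction
martingale exists (`sle_exists_isRestrictionMartingale`, [LSW] Prop. 5.2–5.3) and every
restriction martingale converges a.s. to the indicator of `{T = ∞}` (hypothesis `hlim`; in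
print Lemmas 6.2–6.3 give this for smooth hulls in `𝒬₊ ∪ 𝒬₋`, and Prop. 3.3 (4) ⇒ (3) — smooth
approximation, Lemma 2.1 — reduces Thm. 6.1 to that case), then
`P[γ[0, ∞) ∩ A = ∅] = Φ'_A(0)^{5/8}` for all `A ∈ 𝒬*` (`sle_restriction_eightThirds`), given
uniqueness of `Φ_A` (`huniq`) and that the pre-Wiener measure is a probability measure.
[cite: LawlerSchrammWerner2003Restriction, proof of Thm. 6.1 (§6)] -/
theorem sle_restriction_eightThirds_of_martingale [Fact Process.isProjectiveLimit_preWienerMeasure]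
    (huniq : IsStarHull.existsUnique_isRestrictionMap) (hM : sle_exists_isRestrictionMartingale)
    (hlim : ∀ {A : Set ℂ}, IsStarHull A → ∀ {Y : ℝ≥0 → (ℝ≥0 → ℝ) → ℝ},
      IsRestrictionMartingale A Y → ∀ᵐ ω ∂Process.preWienerMeasure, Tendsto (fun t ↦ Y t ω) atTop
        (𝓝 (if firstHit (sleTrace ((8 : ℝ≥0) / 3) ω) A = ⊤ then 1 else 0))) :
    sle_restriction_eightThirds := by
  intro A hA Φ hΦ d hd
  obtain ⟨Y, hY⟩ := hM hA
  exact hY.measure_disjoint_eq huniq hA hΦ hd (hlim hA hY)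

/-- **[LSW] Thm. 6.1 from its three printed inputs**: the restriction martingales (Prop. 5.2,
5.3: `sle_exists_isRestrictionMartingale`) and the two limit properties (Lemmas 6.2, 6.3) for
every `*`-hull — hypotheses `h62`, `h63`; in print they are established for smooth hulls in
`𝒬₊ ∪ 𝒬₋` and Thm. 6.1 is first reduced to those by Prop. 3.3 (4) ⇒ (3) — give
`sle_restriction_eightThirds`, given uniqueness of `Φ_A` (`huniq`).
[cite: LawlerSchrammWerner2003Restriction, proof of Thm. 6.1 (§6)] -/
theorem sle_restriction_eightThirds_of_limits [Fact Process.isProjectiveLimit_preWienerMeasure]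
    (huniq : IsStarHull.existsUnique_isRestrictionMap) (hM : sle_exists_isRestrictionMartingale)
    (h62 : ∀ {A : Set ℂ}, IsStarHull A → sle_restrictionDeriv_frequently_gt A)
    (h63 : ∀ {A : Set ℂ}, IsStarHull A → sle_restrictionDeriv_frequently_lt A) :
    sle_restriction_eightThirds := by
  intro A hA Φ hΦ d hd
  obtain ⟨Y, hY⟩ := hM hA
  exact hY.measure_disjoint_eq_of_limits huniq hA hΦ hd (h62 hA) (h63 hA)

end Literature.Probability.RandomPlanarGeometry

end
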